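import Literature.Topology.FourManifolds.FishtailPathTube
import Literature.Topology.FourManifolds.FishtailFace
import HarnessLib

/-!
# The tube about the handle leg of Gompf's disc, with the corner shear undone

Infrastructure for the explicit fishtail neighbourhood (R. Gompf, *More Cappell–Shaneson spheres
are standard*, Algebr. Geom. Topol. 10 (2010), proof of Thm 2.1 and Lemma 2.2 (`Φ = N ∪_γ h`);
the named fact `Literature.Topology.FourManifolds.gompf2010_framedTwist`). Just below the hole
`γ = {(n_j, y_h, t = 1)} × 𝕊¹_ℓ` the disc `D` is the leg `{(n_j, y_h)} × [t] × 𝕊¹_ℓ`. Read through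
the handle identification (`FishtailLambda.lean`) and Gompf's bend (`FishtailBendV2.lean`, in
handle mode), the end of the fishtail model arrives on the leg with the normal offset `w = a + ib`
rotated by the fibre angle and with the position along the leg *sheared* by the normal radius:
`t = 1 + h ((r - cρ_b) + 2c (ρ_b - |w|))`. This file provides the tube about the leg which
undoes that shear over a window of the position `r`:

* `Literature.Topology.FourManifolds.legT μ c ρb r m = 1 + h ((r - cρ_b) + 2c (ρ_b - m) μ(r))` and
  `Literature.Topology.FourManifolds.legTubeMap μ c ρb n_j y_h` :
  `(r, ϑ, a, b) ↦ (n_j + re (e^{iϑ} w), y_h + im (e^{iϑ} w), ϑ, legT r |w|)`;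
* its `r`-derivative `h (1 + 2c (ρ_b - m) μ′(r))` (`hasDerivAt_legT`), positive when
  `2c (ρ_b - m) |μ′| < 1`; local diffeomorphism where `w ≠ 0` and that derivative is nonzero
  (`isLocalDiffeomorphAt_legTubeMap`), injectivity from strict monotonicity in `r`
  (`legTubeMap_inj`); at `μ = 0` the tube is the flat end of the path tube
  (`legTubeMap_of_mu_zero`, cf. `pathTubeMap` with the flat shell).

Everything is proved; no named facts.

## References

* R. E. Gompf, *More Cappell–Shaneson spheres are standard*, Algebr. Geom. Topol. 10 (2010)
  1665–1681, proof of Thm 2.1 and Lemma 2.2. [GompfAGT2010]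
-/

noncomputable section

open scoped Real ContDiff Topology Manifold
open Set Function Filter Complex

namespace Literature.Topology.FourManifolds

section Leg

variable (μ : ℝ → ℝ) (c ρb : ℝ)

/-- **The position along the leg with the corner shear partially undone**:
`legT r m = 1 + h ((r - cρ_b) + 2c (ρ_b - m) μ(r))`. [folklore] -/
def legT (r m : ℝ) : ℝ := 1 + bxH * ((r - c * ρb) + 2 * c * (ρb - m) * μ r)

variable (nj yh : ℝ)

/-- **The tube about the leg**: `(r, ϑ, a, b) ↦ (n_j + re (e^{iϑ} w), y_h + im (e^{iϑ} w), ϑ, legT r |w|)`,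
`w = a + ib`. [cite: GompfAGT2010, Lemma 2.2 (Φ = N ∪_γ 2-handle: the collar of ∂Φ along the handle)] -/
def legTubeMap (q : ℝ × ℝ × ℝ × ℝ) : ℝ × ℝ × ℝ × ℝ :=
  (nj + (exp (q.2.1 * I) * (q.2.2.1 + q.2.2.2 * I)).re, yh + (exp (q.2.1 * I) * (q.2.2.1 + q.2.2.2 * I)).im, q.2.1,
    legT μ c ρb q.1 (Real.sqrt (q.2.2.1 ^ 2 + q.2.2.2 ^ 2)))

variable {μ c ρb nj yh}

/-- The rotated offset in terms of `rotAB`: `re (e^{iϑ} w) = (rotAB ϑ a b).2`, `im (e^{iϑ} w) = -(rotAB ϑ a b).1`. [folklore] -/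
theorem re_im_rot (ϑ a b : ℝ) :
    (exp (ϑ * I) * (a + b * I)).re = (rotAB ϑ a b).2 ∧ (exp (ϑ * I) * (a + b * I)).im = -(rotAB ϑ a b).1 := by
  constructor
  · simp [rotAB, mul_re, exp_ofReal_mul_I_re, exp_ofReal_mul_I_im]; ring
  · simp [rotAB, mul_im, exp_ofReal_mul_I_re, exp_ofReal_mul_I_im]; ring

/-- **At `μ = 0` the leg tube is the flat end of the path tube** with the flat shell
`(u₀, ã) ↦ (u₀, ã)` and `t₀ = 1 - h cρ_b`, position `u₀ = h r`. [folklore] -/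
theorem legTubeMap_of_mu_zero {q : ℝ × ℝ × ℝ × ℝ} (h : μ q.1 = 0) :
    legTubeMap μ c ρb nj yh q =
      pathTubeMap (fun p : ℝ × ℝ ↦ p) nj yh (1 - bxH * (c * ρb)) (bxH * q.1, q.2.1, q.2.2.1, q.2.2.2) := by
  obtain ⟨hre, him⟩ := re_im_rot q.2.1 q.2.2.1 q.2.2.2
  simp only [legTubeMap, pathTubeMap, legT, h, hre, him]
  refine Prod.ext rfl (Prod.ext (by ring) (Prod.ext rfl (by ring)))

/-- **The `r`-derivative of the position**: `h (1 + 2c (ρ_b - m) μ′(r))`. [folklore] -/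
theorem hasDerivAt_legT (hμ : ContDiff ℝ ∞ μ) (r m : ℝ) :
    HasDerivAt (fun r' ↦ legT μ c ρb r' m) (bxH * (1 + 2 * c * (ρb - m) * deriv μ r)) r := by
  have hμ' : HasDerivAt μ (deriv μ r) r := ((hμ.differentiable (by simp)) r).hasDerivAt
  unfold legT
  have h1 : HasDerivAt (fun r' ↦ (r' - c * ρb) + 2 * c * (ρb - m) * μ r') (1 + 2 * c * (ρb - m) * deriv μ r) r :=
    ((hasDerivAt_id r).sub_const _).add (hμ'.const_mul _)
  exact (h1.const_mul bxH).const_add 1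

/-- Positivity of the `r`-derivative when `2 |c| |ρ_b - m| |μ′| < 1`. [folklore] -/
theorem deriv_legT_pos {r m M : ℝ} (hM : |deriv μ r| ≤ M) (hsmall : 2 * |c| * |ρb - m| * M < 1) :
    0 < bxH * (1 + 2 * c * (ρb - m) * deriv μ r) := by
  refine mul_pos bxH_pos ?_
  have h1 : |2 * c * (ρb - m) * deriv μ r| ≤ 2 * |c| * |ρb - m| * M := by
    rw [abs_mul, abs_mul, abs_mul, abs_two]
    gcongr
  have h2 := neg_abs_le (2 * c * (ρb - m) * deriv μ r)
  linarith

/-- The value of the affine output map `pathOut`. [folklore] -/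
@[simp] theorem pathOut_apply (nj yh t₀ : ℝ) (p : (ℝ × ℝ) × (ℝ × ℝ)) :
    pathOut nj yh t₀ p = (nj + p.1.2, yh - p.2.2, p.1.1, t₀ + p.2.1) := rfl

/-- The tube factors: `legTubeMap = pathOut n_j y_h 0 ∘ ((ϑ, b̃), (legT r |w|, ã)) ∘ …`. [folklore] -/
theorem legTubeMap_eq (q : ℝ × ℝ × ℝ × ℝ) :
    legTubeMap μ c ρb nj yh q =
      pathOut nj yh 0 ((pathRot q).1, (legT μ c ρb q.1 (Real.sqrt (q.2.2.1 ^ 2 + q.2.2.2 ^ 2)), (pathRot q).2.2)) := by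
  obtain ⟨hre, him⟩ := re_im_rot q.2.1 q.2.2.1 q.2.2.2
  simp only [legTubeMap, hre, him, pathOut_apply, pathRot_apply]
  refine Prod.ext rfl (Prod.ext (by ring) (Prod.ext rfl (by ring)))

/-- The norm `|w|` in terms of the rotated offset: `ã² + b̃² = a² + b²`. [folklore] -/
theorem rotAB_sq (ℓ a b : ℝ) : (rotAB ℓ a b).1 ^ 2 + (rotAB ℓ a b).2 ^ 2 = a ^ 2 + b ^ 2 := by
  simp only [rotAB]
  linear_combination (a ^ 2 + b ^ 2) * Real.sin_sq_add_cos_sq ℓ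

/-- **The tube about the leg is a local diffeomorphism** at `(r, ϑ, a, b)` when `μ` is smooth,
`w = a + ib ≠ 0`, and the `r`-derivative of the position does not vanish. [folklore] -/
theorem isLocalDiffeomorphAt_legTubeMap (hμ : ContDiff ℝ ∞ μ) {q : ℝ × ℝ × ℝ × ℝ}
    (hw : q.2.2.1 ^ 2 + q.2.2.2 ^ 2 ≠ 0)
    (hder : bxH * (1 + 2 * c * (ρb - Real.sqrt (q.2.2.1 ^ 2 + q.2.2.2 ^ 2)) * deriv μ q.1) ≠ 0) :
    IsLocalDiffeomorphAt 𝓘(ℝ, ℝ × ℝ × ℝ × ℝ) 𝓘(ℝ, ℝ × ℝ × ℝ × ℝ) ∞ (legTubeMap μ c ρb nj yh) q := by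
  -- after `pathRot` (which carries `(ϑ, b̃)` and `(r, ã)`), the map is the graph of
  -- `r ↦ legT r √(ã² + b̃²)` over the carried `((ϑ, b̃), ã)`
  have h1 : IsLocalDiffeomorphAt 𝓘(ℝ, ℝ × ℝ × ℝ × ℝ) 𝓘(ℝ, (ℝ × ℝ) × (ℝ × ℝ)) ∞ pathRot q := pathRot.isLocalDiffeomorph q
  -- reorder `((ϑ, b̃), (r, ã)) ↦ (((ϑ, b̃), ã), r)`
  let K : ((ℝ × ℝ) × (ℝ × ℝ)) ≃L[ℝ] (((ℝ × ℝ) × ℝ) × ℝ) :=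
    { toFun := fun p ↦ ((p.1, p.2.2), p.2.1)
      invFun := fun s ↦ (s.1.1, (s.2, s.1.2))
      map_add' := fun _ _ ↦ rfl
      map_smul' := fun _ _ ↦ rfl
      left_inv := fun _ ↦ rfl
      right_inv := fun _ ↦ rfl
      continuous_toFun := by fun_prop
      continuous_invFun := by fun_prop }
  have h2 := K.toDiffeomorph.isLocalDiffeomorph (pathRot q)
  set s₀ : ((ℝ × ℝ) × ℝ) × ℝ := K (pathRot q) with hs₀
  have hm : ∀ s : ((ℝ × ℝ) × ℝ) × ℝ, Real.sqrt (s.1.2 ^ 2 + s.1.1.2 ^ 2) = Real.sqrt (s.1.2 ^ 2 + s.1.1.2 ^ 2) := fun _ ↦ rfl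
  have h3 : IsLocalDiffeomorphAt 𝓘(ℝ, ((ℝ × ℝ) × ℝ) × ℝ) 𝓘(ℝ, ((ℝ × ℝ) × ℝ) × ℝ) ∞
      (fun s : ((ℝ × ℝ) × ℝ) × ℝ ↦ (s.1, legT μ c ρb s.2 (Real.sqrt (s.1.2 ^ 2 + s.1.1.2 ^ 2)))) s₀ := by
    set U : Set (((ℝ × ℝ) × ℝ) × ℝ) := {s | s.1.2 ^ 2 + s.1.1.2 ^ 2 ≠ 0} with hU
    have hUo : IsOpen U := by
      rw [hU]
      exact isOpen_ne_fun (((continuous_snd.comp continuous_fst).pow 2).add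
        ((continuous_snd.comp (continuous_fst.comp continuous_fst)).pow 2)) continuous_const
    have hmem : s₀ ∈ U := by
      rw [hU, hs₀]
      show (pathRot q).2.2 ^ 2 + (pathRot q).1.2 ^ 2 ≠ 0
      simp only [pathRot_apply]
      rw [rotAB_sq]; exact hw
    have hf : ContDiffOn ℝ ∞ (fun s : ((ℝ × ℝ) × ℝ) × ℝ ↦ legT μ c ρb s.2 (Real.sqrt (s.1.2 ^ 2 + s.1.1.2 ^ 2))) U := by
      intro s hs
      refine ContDiffAt.contDiffWithinAt ?_
      unfold legT
      have hsq : ContDiffAt ℝ ∞ (fun s : ((ℝ × ℝ) × ℝ) × ℝ ↦ Real.sqrt (s.1.2 ^ 2 + s.1.1.2 ^ 2)) s := by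
        refine ContDiffAt.sqrt ?_ hs
        exact ((contDiffAt_snd.comp s contDiffAt_fst).pow 2).add
          ((contDiffAt_snd.comp s (contDiffAt_fst.comp s contDiffAt_fst)).pow 2)
      have hμs : ContDiffAt ℝ ∞ (fun s : ((ℝ × ℝ) × ℝ) × ℝ ↦ μ s.2) s := hμ.contDiffAt.comp s contDiffAt_snd
      exact contDiffAt_const.add (contDiffAt_const.mul ((contDiffAt_snd.sub contDiffAt_const).add
        (((contDiffAt_const.mul (contDiffAt_const.sub hsq)).mul hμs))))
    have hd := hasDerivAt_legT (c := c) (ρb := ρb) hμ s₀.2 (Real.sqrt (s₀.1.2 ^ 2 + s₀.1.1.2 ^ 2))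
    have hder' : bxH * (1 + 2 * c * (ρb - Real.sqrt (s₀.1.2 ^ 2 + s₀.1.1.2 ^ 2)) * deriv μ s₀.2) ≠ 0 := by
      have e1 : s₀.1.2 ^ 2 + s₀.1.1.2 ^ 2 = q.2.2.1 ^ 2 + q.2.2.2 ^ 2 := by
        rw [hs₀]
        show (pathRot q).2.2 ^ 2 + (pathRot q).1.2 ^ 2 = _
        simp only [pathRot_apply]
        exact rotAB_sq _ _ _
      have e2 : s₀.2 = q.1 := rfl
      rw [e1, e2]; exact hder
    exact isLocalDiffeomorphAt_graph_real hUo hmem hf (by exact_mod_cast le_top) hder' hd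
  have h4 := K.symm.toDiffeomorph.isLocalDiffeomorph (s₀.1, legT μ c ρb s₀.2 (Real.sqrt (s₀.1.2 ^ 2 + s₀.1.1.2 ^ 2)))
  have h5 := (pathOut nj yh 0).isLocalDiffeomorph
    (K.symm (s₀.1, legT μ c ρb s₀.2 (Real.sqrt (s₀.1.2 ^ 2 + s₀.1.1.2 ^ 2))))
  have h := (((h1.comp (K := 𝓘(ℝ, ((ℝ × ℝ) × ℝ) × ℝ)) (P := ((ℝ × ℝ) × ℝ) × ℝ) h2).comp
    (K := 𝓘(ℝ, ((ℝ × ℝ) × ℝ) × ℝ)) (P := ((ℝ × ℝ) × ℝ) × ℝ) h3).comp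
    (K := 𝓘(ℝ, (ℝ × ℝ) × (ℝ × ℝ))) (P := (ℝ × ℝ) × (ℝ × ℝ)) h4).comp
    (K := 𝓘(ℝ, ℝ × ℝ × ℝ × ℝ)) (P := ℝ × ℝ × ℝ × ℝ) h5
  refine isLocalDiffeomorphAt_congr_nhds' h (Eventually.of_forall fun q' ↦ ?_)
  rw [legTubeMap_eq]
  show _ = pathOut nj yh 0 (K.symm ((K (pathRot q')).1,
    legT μ c ρb (K (pathRot q')).2 (Real.sqrt ((K (pathRot q')).1.2 ^ 2 + (K (pathRot q')).1.1.2 ^ 2))))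
  congr 1
  refine Prod.ext rfl (Prod.ext ?_ rfl)
  show legT μ c ρb q'.1 (Real.sqrt (q'.2.2.1 ^ 2 + q'.2.2.2 ^ 2)) =
    legT μ c ρb q'.1 (Real.sqrt ((rotAB q'.2.1 q'.2.2.1 q'.2.2.2).1 ^ 2 + (rotAB q'.2.1 q'.2.2.1 q'.2.2.2).2 ^ 2))
  rw [rotAB_sq]

/-- **Injectivity of the tube about the leg** on a slab `r ∈ [r₁, r₂]` where the position is
strictly increasing for the offsets in question. [folklore] -/
theorem legTubeMap_inj {r₁ r₂ : ℝ} {q q' : ℝ × ℝ × ℝ × ℝ} (hq : q.1 ∈ Icc r₁ r₂) (hq' : q'.1 ∈ Icc r₁ r₂)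
    (hmono : StrictMonoOn (fun r ↦ legT μ c ρb r (Real.sqrt (q.2.2.1 ^ 2 + q.2.2.2 ^ 2))) (Icc r₁ r₂))
    (h : legTubeMap μ c ρb nj yh q = legTubeMap μ c ρb nj yh q') : q = q' := by
  obtain ⟨hre, him⟩ := re_im_rot q.2.1 q.2.2.1 q.2.2.2
  obtain ⟨hre', him'⟩ := re_im_rot q'.2.1 q'.2.2.1 q'.2.2.2
  simp only [legTubeMap, Prod.mk.injEq, add_right_inj] at h
  obtain ⟨hR, hI, hℓ, hT⟩ := h
  rw [hre, hre'] at hR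
  rw [him, him', neg_inj] at hI
  have hrot : rotAB q.2.1 q.2.2.1 q.2.2.2 = rotAB q'.2.1 q'.2.2.1 q'.2.2.2 := Prod.ext hI hR
  have hab : (q.2.2.1, q.2.2.2) = (q'.2.2.1, q'.2.2.2) := by
    rw [← rotABInv_rotAB q.2.1 q.2.2.1 q.2.2.2, ← rotABInv_rotAB q'.2.1 q'.2.2.1 q'.2.2.2, hrot, hℓ]
  simp only [Prod.mk.injEq] at hab
  obtain ⟨ha, hb⟩ := hab
  rw [← ha, ← hb] at hT
  have hr : q.1 = q'.1 := hmono.injOn hq hq' hT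
  exact Prod.ext hr (Prod.ext hℓ (Prod.ext ha hb))

/-- **Strict monotonicity of the position on a slab** from a positive derivative. [folklore] -/
theorem strictMonoOn_legT (hμ : ContDiff ℝ ∞ μ) {r₁ r₂ m : ℝ}
    (hpos : ∀ r ∈ Icc r₁ r₂, 0 < bxH * (1 + 2 * c * (ρb - m) * deriv μ r)) :
    StrictMonoOn (fun r ↦ legT μ c ρb r m) (Icc r₁ r₂) := by
  refine strictMonoOn_of_deriv_pos (convex_Icc r₁ r₂) ?_ fun r hr ↦ ?_
  · exact fun r _ ↦ (hasDerivAt_legT hμ r m).continuousAt.continuousWithinAt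
  · rw [interior_Icc] at hr
    rw [(hasDerivAt_legT (c := c) (ρb := ρb) hμ r m).deriv]
    exact hpos r (Ioo_subset_Icc_self hr)

end Leg

end Literature.Topology.FourManifolds
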